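import Summits.KontsevichZagierPeriods.KontsevichZagierPeriods.Theses.FurushoPentagon

/-!
# F1 restatement of `closes` WITHOUT `ReducedPeriodRing` — elaboration sketch for the route planner

Lead a1 of crux stmt-KontsevichZagierPeriods-3929 (D-0014 note made checkable). With the remainder restated as
`KernelModuloPeriodConjectureF1 := MzvPeriodConjecture → PentagonInKZ → SectorToKernel` (one antecedent fewer than
the current `KernelModuloPeriodConjecture`, hence a STRONGER hypothesis on paper but with the same on-sector content,
see `Cruxes/ReducedPeriodRing/F1-bypass.md`), the deciding theorem elaborates with `hR` gone and the same 4-line proof.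
Both directions of the bookkeeping are recorded: the current remainder follows from the F1 one (`fun h z p _ => h z p`),
and under the crux they are equivalent.
-/

namespace Summit.KontsevichZagierPeriods.FurushoPentagon.ReducedPeriodRing.F1ClosesSketch

open Summit.KontsevichZagierPeriods.KontsevichZagierPeriods.Theses.FurushoPentagon

/-- The F1 remainder: the current `KernelModuloPeriodConjecture` with the `ReducedPeriodRing` antecedent dropped. -/
def KernelModuloPeriodConjectureF1 : Prop :=
  MzvPeriodConjecture → PentagonInKZ → SectorToKernel

/-- The current remainder is implied by the F1 remainder. -/
theorem kernelModuloPeriodConjecture_of_F1 (h : KernelModuloPeriodConjectureF1) :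
    KernelModuloPeriodConjecture :=
  fun hZ hP _ => h hZ hP

/-- Under the crux the two remainders are equivalent. -/
theorem kernelModuloPeriodConjectureF1_iff_of_reduced (hR : ReducedPeriodRing) :
    KernelModuloPeriodConjectureF1 ↔ KernelModuloPeriodConjecture :=
  ⟨kernelModuloPeriodConjecture_of_F1, fun h hZ hP => h hZ hP hR⟩

/-- `closes` restated without `hR` (same proof as the route's deciding theorem). -/
theorem closesF1 (hP : PentagonInKZ) (hZ : MzvPeriodConjecture) (hC : KernelModuloPeriodConjectureF1)
    (hS : StuffleInKZ) (hH : HoffmanRelationInKZ) : KontsevichZagierPeriods := by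
  intro n m r r' _ _ hv
  have h0 : Literature.NumberTheory.Transcendental.KZ.eval
      (Literature.NumberTheory.Transcendental.KZ.of r - Literature.NumberTheory.Transcendental.KZ.of r') = 0 := by
    simp [Literature.NumberTheory.Transcendental.KZ.eval_of, hv]
  exact hC hZ hP hS hH _ h0

end Summit.KontsevichZagierPeriods.FurushoPentagon.ReducedPeriodRing.F1ClosesSketch
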